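import Summits.Ventures.PercRepro.ClassPositive
import Summits.Ventures.PercRepro.C028

/-!
# C-028: the class-level form gives the probability statement (typer-2, gen 10)

`C028Class` (mine-4's census statement: on every marked multigraph `badbot² ≤ ac · bc`, the counts
over all `S ⊆ E`) implies `C028` (the row: `d ≤ √(y₂ · y₃)` at every `p ∈ [0, 1]^E`) —
**`C028_of_C028Class`**, on the lead's order (ml).  The route:

* `d`, `y₂`, `y₃` are the quadratic forms at `p` of `kernel28`, `rowKernel3 2`, `rowKernel3 3`
  (**`quadForm_kernel28`**, **`quadForm_rowKernel3`**; from p5's `quadForm_kernel26`,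
  `kernel28_eq` and `law3_eq_sum_rowInd3`);
* `quadForm_eq_sum_faces` (ClassPositive) writes each quadratic form as a sum over the classes
  `(u, v)`, `v ≤ u`, of the SAME nonnegative weights `w(v) · w(u)` times the class sum of the
  kernel, and `faceSumQuad_eq_minor` (the antipodal principle, ClassPositive) identifies each class
  sum with the full-cube class sum of the marked minor `G.minor u v`, on which `C028Class` gives
  `badbot_f² ≤ ac_f · bc_f`;
* the weighted Cauchy–Schwarz inequality in its square-root-free form, Mathlib's
  `Finset.sum_sq_le_sum_mul_sum_of_sq_le_mul` (`r_f² ≤ f_f · g_f`, `f, g ≥ 0` ⇒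
  `(Σ r)² ≤ (Σ f)(Σ g)`), with `r_f = w_f · badbot_f`, `f_f = w_f · ac_f`, `g_f = w_f · bc_f`, gives
  `d² ≤ y₂ · y₃`, and `Real.le_sqrt_of_sq_le` the row.

With it mine-4's class-level census (§23 of `conjectures/MINE-4.md`, `badbot² ≤ ac · bc` on every
marked minor of the censused graphs) is a census of the ROW's statement at every `p` on those
graphs; `C028Class` itself stays open (P 0).
-/

namespace PercRepro

open Finset

namespace MultiGraph

variable {V E : Type*} (G : MultiGraph V E) [Fintype E] [DecidableEq E]

/-- **The quadratic form of a row kernel is the row**: `Q_{[σ = row s]}(p) = law3 s`. -/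
theorem quadForm_rowKernel3 (p : E → ℝ) (a b c : V) (s : Fin 5) :
    G.quadForm p ![a, b, c] (rowKernel3 s) = G.law3 p a b c s := by
  unfold quadForm rowKernel3
  rw [sum_sum_weight_mul_left, law3_eq_sum_rowInd3]

/-- **The quadratic form of `kernel28` is the Harris defect** `d = (x + y₁)(y₁ + z) − y₁`. -/
theorem quadForm_kernel28 (p : E → ℝ) (a b c : V) :
    G.quadForm p ![a, b, c] kernel28 =
      (G.law3 p a b c 0 + G.law3 p a b c 1) * (G.law3 p a b c 1 + G.law3 p a b c 4) -
        G.law3 p a b c 1 := by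
  have hlin : G.quadForm p ![a, b, c] kernel28 =
      G.quadForm p ![a, b, c] (rowKernel3 2) + G.quadForm p ![a, b, c] (rowKernel3 3) -
        G.quadForm p ![a, b, c] kernel26 := by
    unfold quadForm
    simp only [kernel28_eq, rowKernel3, mul_add, mul_sub, Finset.sum_add_distrib,
      Finset.sum_sub_distrib]
  rw [hlin, G.quadForm_kernel26 p a b c, G.quadForm_rowKernel3 p a b c 2,
    G.quadForm_rowKernel3 p a b c 3]
  ring

/-- The class sum of a row kernel is nonnegative (a count of configurations). -/
theorem faceSumQuad_rowKernel3_nonneg (m : Fin 3 → V) (s : Fin 5) (u v : Config E) :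
    0 ≤ G.faceSumQuad m (rowKernel3 s) u v := by
  unfold faceSumQuad faceSum rowKernel3
  exact Finset.sum_nonneg fun _ _ => rowInd3_nonneg _ _

end MultiGraph

/-- **The class-level form of C-028 gives the row** (`C028Class → C028`): the three quadratic
forms `d`, `y₂`, `y₃` are sums over the classes `(u, v)` of the same nonnegative weights times
the class sums `badbot_f`, `ac_f`, `bc_f` (`quadForm_eq_sum_faces`), each class sum is the
full-cube class sum of the marked minor (`faceSumQuad_eq_minor`, the antipodal principle) on
which `C028Class` gives `badbot_f² ≤ ac_f · bc_f`, and the weighted Cauchy–Schwarz inequality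
`Finset.sum_sq_le_sum_mul_sum_of_sq_le_mul` gives `d² ≤ y₂ · y₃`. -/
theorem C028_of_C028Class (h : C028Class) : C028 := by
  intro V E _ _ G p hp a b c
  rw [← G.quadForm_kernel28 p a b c, ← G.quadForm_rowKernel3 p a b c 2,
    ← G.quadForm_rowKernel3 p a b c 3]
  apply Real.le_sqrt_of_sq_le
  rw [G.quadForm_eq_sum_faces, G.quadForm_eq_sum_faces, G.quadForm_eq_sum_faces]
  have hw : ∀ uv : Config E × Config E, 0 ≤ weight p uv.2 * weight p uv.1 :=
    fun uv => mul_nonneg (weight_nonneg hp _) (weight_nonneg hp _)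
  refine Finset.sum_sq_le_sum_mul_sum_of_sq_le_mul _ ?_ ?_ ?_
  · intro uv _
    refine mul_nonneg (hw uv) ?_
    split_ifs
    · exact G.faceSumQuad_rowKernel3_nonneg _ _ _ _
    · exact le_rfl
  · intro uv _
    refine mul_nonneg (hw uv) ?_
    split_ifs
    · exact G.faceSumQuad_rowKernel3_nonneg _ _ _ _
    · exact le_rfl
  · intro uv _
    split_ifs with huv
    · have hm := h (G.minor uv.1 uv.2) (fun i => G.sureClass uv.2 (![a, b, c] i))
      rw [← G.faceSumQuad_eq_minor ![a, b, c] kernel28 uv.1 uv.2,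
        ← G.faceSumQuad_eq_minor ![a, b, c] (rowKernel3 2) uv.1 uv.2,
        ← G.faceSumQuad_eq_minor ![a, b, c] (rowKernel3 3) uv.1 uv.2] at hm
      calc (weight p uv.2 * weight p uv.1 * G.faceSumQuad ![a, b, c] kernel28 uv.1 uv.2) ^ 2
          = (weight p uv.2 * weight p uv.1) ^ 2 *
              (G.faceSumQuad ![a, b, c] kernel28 uv.1 uv.2) ^ 2 := by ring
        _ ≤ (weight p uv.2 * weight p uv.1) ^ 2 *
              (G.faceSumQuad ![a, b, c] (rowKernel3 2) uv.1 uv.2 *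
                G.faceSumQuad ![a, b, c] (rowKernel3 3) uv.1 uv.2) :=
            mul_le_mul_of_nonneg_left hm (sq_nonneg _)
        _ = (weight p uv.2 * weight p uv.1 * G.faceSumQuad ![a, b, c] (rowKernel3 2) uv.1 uv.2) *
              (weight p uv.2 * weight p uv.1 *
                G.faceSumQuad ![a, b, c] (rowKernel3 3) uv.1 uv.2) := by ring
    · simp

end PercRepro
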